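import Summits.BirchSwinnertonDyer.BirchSwinnertonDyer.Theorems.PrintCf2RamifiedOffTYZGaloisMotionDoor
import Literature.NumberTheory.EllipticCurves.TianYuanZhang2017.CurveAFourTorsion
import Mathlib.SetTheory.Cardinal.Finite
import HarnessLib

/-!
# Route `PrintCf2`, crux stmt-BirchSwinnertonDyer-20509 `RamifiedOffTYZOfFacts` — THE GALOIS-MOVER DOOR FOR EVEN `n ≡ 6 (mod 8)`
# (cell `bsd-print-cf2`, LEAD of 20509 g5, line `offtyz-v7`, lineage cycle 6; sequel of `…GaloisMotionDoor` (p672160); fact-free, no `def`)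

HONEST FRAMING (crux 20509 DECIDING, OPEN AS A CLASS): every theorem is a kernel implication from the displayed printed sentences of
Tian–Yuan–Zhang 2017 §3 carried by `D : GenusPointData n` (`thm35Main`, `scriptLSpec`, `lemma318`) and from the tree's proved
`2`-descent / Mordell–Weil / BSD-door lemmas; nothing is asserted, no count moves.  The odd door `GaloisMotion.rankOne_sha_bsdp_two_
congruentNumberCurve_of_selmerEight_of_mover` (g4) is stated for `n ≡ 5, 7 (mod 8)` because its torsion lemma uses Lemma 3.18's ODD
clause `A(ℍ′_n)_tor = A[(1+i)³]`.  For EVEN `n` Lemma 3.18 says `A(ℍ′_n)_tor = A[4]` (display: every torsion point is killed by `4`,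
and there are `16` such points); the tree's `CurveAFourTorsion` exhibits the sixteen points `a·τ(1/2) + b·ptQ` (`a, b ∈ ℤ/4`) with
coordinates in `ℚ(i, √2)`, and `√2 = i·√−2 ∈ ℍ′_n` is fixed by every automorphism fixing `i` and `√−2`.  Hence:

* §1 `exists_eq_nsmul_tauHalf_add_nsmul_ptQ`: over any field `H ∋ i, √2` of characteristic `0`, every `Q` with `4·Q = 0` is
  `a·τ(1/2) + b·ptQ` (the injection `ℤ/4 × ℤ/4 → A(H)[4]` of `CurveAFourTorsion` is onto, both sides having `16` elements).
* §2 `galPt_eq_self_of_isOfFinAddOrder_even`: for EVEN `n`, every torsion point of `A(ℍ′_n)` is fixed by every `g ∈ Aut_ℚ(ℍ′_n)` with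
  `g(i) = i`, `g(√−2) = √−2` (Lemma 3.18 even clause + §1); `not_isOfFinAddOrder_of_mover_even`, `scriptL_ne_zero_of_mover_even`.
* §3 **`rankOne_sha_bsdp_two_congruentNumberCurve_of_selmerEight_of_mover_even`**: square-free `n ≡ 6 (mod 8)`, `#Sel₂(E_n) = 8`,
  `D` with the three displays, `g` fixing `i` and all `√−d` (`d ∣ n`) with `g·P(n) ≠ P(n)` ⟹ `𝓛(n)` odd, `ord_{s=1} L(E_n,s) = 1`,
  `rank = 1`, `Ш[2^∞] = ⊥`, `BSD(E_n, 2)` — the proof of p672160 verbatim with the even torsion lemma; `_of_tyz` version.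

WHY (LEAD note `Cruxes/RamifiedOffTYZOfFacts/Lines/offtyz_v7_QForm.md` §8): for `n ≡ 6 (mod 8)` the mover class has the invariant
`Q_n ∈ H²(Gal(L_n(i)/ℚ), 𝔽₂)` with «mover ⟺ Q_n ≠ 0» and the instrument finds «Q_n ≠ 0 ⟺ s(n) = 1» on every Legendre sign pattern
with ≤ 4 odd primes (1 114 patterns) and 4 200 random ones with 5 — so, granted the identity (★) of that note, this door applies to
EVERY square-free `n ≡ 6 (mod 8)` with `#Sel₂(E_n) = 8`.  Beyond-print theorem: NO at the kernel level (the mover is a hypothesis).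
BSD is not proved by any of this; no class is closed by this file.

References: [cite: TianYuanZhang2017, Thm. 3.5 (p0011 L94–L100), Lemma 3.18 (p0017 L152–L153), Lemma 3.16 (p0017 L98–L101)];
[cite: SilvermanAEC2009, Thm. X.4.2, III.6.4]; [cite: Miller2011LMS, Def. 1.1]; tree: `…GaloisMotionDoor` (p672160), `…GaloisMotion` (p671505),
`Literature/…/TianYuanZhang2017/CurveAFourTorsion` (`ptQ`, `addOrderOf_ptQ`, `nsmul_tauHalf_eq_nsmul_ptQ`, `card_four_torsion_eq_sixteen`).
-/

noncomputable section

open scoped Classical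

open WeierstrassCurve WeierstrassCurve.Affine Literature.NumberTheory.EllipticCurves
  Literature.NumberTheory.EllipticCurves.Rank1Residual Summit.BirchSwinnertonDyer.Rank1Residual
  Literature.NumberTheory.EllipticCurves.TianYuanZhang2017
  Literature.NumberTheory.EllipticCurves.TianYuanZhang2017.W2
  Literature.NumberTheory.EllipticCurves.SelmerEightShaTwo
  Summit.BirchSwinnertonDyer.PrintCf2.LevelTwoHalfGenerator

set_option autoImplicit false

namespace Summit.BirchSwinnertonDyer.PrintCf2.GaloisMotion

/-! ## §1 `A[4]` over a field containing `i` and `√2`: every `4`-torsion point is `a·τ(1/2) + b·ptQ` -/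

section Curve

variable {H : Type} [Field H] [CharZero H]

/-- **Every `Q ∈ A(H)` with `4·Q = 0` is `a·τ(1/2) + b·ptQ` for some `a, b < 4`** (`H ∋ i, √2` of characteristic `0`): the injection
`(a, b) ↦ a·τ(1/2) + b·ptQ` of `CurveAFourTorsion` hits all `16 = #A(H)[4]` points.
[cite: TianYuanZhang2017, Lemma 3.18 (p0017 L152–L153)] [cite: SilvermanAEC2009, III.6.4] -/
theorem exists_eq_nsmul_tauHalf_add_nsmul_ptQ (im s : H) (him : im ^ 2 = -1) (hs : s ^ 2 = 2)
    {Q : APoint H} (hQ : (4 : ℕ) • Q = 0) :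
    ∃ a b : Fin 4, Q = (a : ℕ) • (tauHalf : APoint H) + (b : ℕ) • ptQ im s him hs := by
  haveI := finite_four_torsion im s him hs
  let f : Fin 4 × Fin 4 → {Q : APoint H // (4 : ℕ) • Q = 0} := fun p =>
    ⟨(p.1 : ℕ) • (tauHalf : APoint H) + (p.2 : ℕ) • ptQ im s him hs, by
      rw [smul_add, smul_comm (4 : ℕ) (p.1 : ℕ), smul_comm (4 : ℕ) (p.2 : ℕ), four_nsmul_tauHalf,
        four_nsmul_ptQ, smul_zero, smul_zero, add_zero]⟩
  have hf : Function.Injective f := by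
    intro p p' h
    have h' := congrArg Subtype.val h
    exact injective_nsmul_add_nsmul_of_addOrderOf_four addOrderOf_tauHalf (addOrderOf_ptQ im s him hs)
      (nsmul_tauHalf_eq_nsmul_ptQ im s him hs) h'
  have hbij : Function.Bijective f := hf.bijective_of_nat_card_le (by
    rw [card_four_torsion_eq_sixteen im s him hs, Nat.card_prod, Nat.card_fin])
  obtain ⟨⟨a, b⟩, hab⟩ := hbij.2 ⟨Q, hQ⟩
  exact ⟨a, b, (congrArg Subtype.val hab).symm⟩

end Curve

variable {n : ℕ}

/-! ## §2 Torsion of `A(ℍ′_n)` is fixed by every automorphism fixing `i` and `√−2` (even `n`) -/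

/-- **Lemma 3.18 (even clause) ⟹ torsion is Galois-inert.** For EVEN `n ≠ 0`, every torsion point of `A(ℍ′_n)` is killed by `4`
(display), hence equals `a·τ(1/2) + b·ptQ(i, √2)` with `√2 = i·√−2` (§1) — a point with coordinates in `ℚ(i, √2)`, fixed by every
`g ∈ Aut_ℚ(ℍ′_n)` with `g(i) = i` and `g(√−2) = √−2`. [cite: TianYuanZhang2017, Lemma 3.18 (p0017 L152–L153)] -/
theorem galPt_eq_self_of_isOfFinAddOrder_even (D : GenusPointData n) (hn0 : n ≠ 0) (heven : Even n) (h318 : D.lemma318)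
    (g : D.H ≃ₐ[ℚ] D.H) (hgi : g D.im = D.im) (hg2 : g (D.sqrtNeg 2) = D.sqrtNeg 2)
    {t : APoint D.H} (ht : IsOfFinAddOrder t) : D.galPt g t = t := by
  have h2 : 2 ∈ n.divisors := Nat.mem_divisors.mpr ⟨even_iff_two_dvd.mp heven, hn0⟩
  have hs : (D.im * D.sqrtNeg 2) ^ 2 = 2 := by
    rw [mul_pow, D.im_sq, D.sqrtNeg_sq 2 h2]; push_cast; ring
  have hgs : g (D.im * D.sqrtNeg 2) = D.im * D.sqrtNeg 2 := by rw [map_mul, hgi, hg2]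
  have h4 : (4 : ℕ) • t = 0 := (h318.2 heven).1 t ht
  obtain ⟨a, b, hab⟩ := exists_eq_nsmul_tauHalf_add_nsmul_ptQ D.im (D.im * D.sqrtNeg 2) D.im_sq hs h4
  have htau : D.galPt g (tauHalf : APoint D.H) = tauHalf := by
    rw [tauHalf]; exact galPt_some_eq_of_fixed D g _ (map_ofNat g 2) (map_ofNat g 4)
  have hptQ : D.galPt g (ptQ D.im (D.im * D.sqrtNeg 2) D.im_sq hs) = ptQ D.im (D.im * D.sqrtNeg 2) D.im_sq hs := by
    rw [ptQ]
    refine galPt_some_eq_of_fixed D g _ ?_ ?_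
    · rw [map_mul, map_mul, map_ofNat, hgi, map_add, map_one, hgs]
    · rw [map_mul, map_add, map_mul, map_ofNat, hgs, map_ofNat, map_sub, map_one, hgi]
  rw [hab, map_add, map_nsmul, map_nsmul, htau, hptQ]

/-- A point moved by an automorphism fixing `i` and `√−2` is NOT torsion (even `n`, Lemma 3.18).
[cite: TianYuanZhang2017, Lemma 3.18 (p0017 L152–L153)] -/
theorem not_isOfFinAddOrder_of_mover_even (D : GenusPointData n) (hn0 : n ≠ 0) (heven : Even n) (h318 : D.lemma318)
    (g : D.H ≃ₐ[ℚ] D.H) (hgi : g D.im = D.im) (hg2 : g (D.sqrtNeg 2) = D.sqrtNeg 2) {X : APoint D.H}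
    (hmove : D.galPt g X ≠ X) : ¬ IsOfFinAddOrder X :=
  fun hX => hmove (galPt_eq_self_of_isOfFinAddOrder_even D hn0 heven h318 g hgi hg2 hX)

/-- **A mover of `P(n)` forces `𝓛(n) ≠ 0`** (even `n`; Thm 3.5: `𝓛(n) = 0` makes `P(n)` torsion, which no `g` fixing `i, √−2` can move).
[cite: TianYuanZhang2017, Thm. 3.5 (p0011 L94–L100), Lemma 3.18 (p0017 L152–L153)] -/
theorem scriptL_ne_zero_of_mover_even (hsq : Squarefree n) (heven : Even n) (D : GenusPointData n)
    (h35 : D.thm35Main) (h318 : D.lemma318)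
    (g : D.H ≃ₐ[ℚ] D.H) (hgi : g D.im = D.im) (hg2 : g (D.sqrtNeg 2) = D.sqrtNeg 2)
    (hmove : D.galPt g (D.P n) ≠ D.P n) : D.scriptL n ≠ 0 := by
  haveI := isElliptic_congruentNumberCurve hsq.ne_zero
  intro h0
  obtain ⟨ρ, hρ⟩ := stub_S3 hsq
  exact not_isOfFinAddOrder_of_mover_even D hsq.ne_zero heven h318 g hgi hg2 hmove
    ((h35 (Nat.mem_divisors_self n hsq.ne_zero) ρ hρ).1 h0)

/-! ## §3 The even door: `#Sel₂ = 8` + a mover ⟹ `𝓛(n)` odd, analytic rank one, rank one, `Ш[2^∞] = 0`, BSD₂ -/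

/-- **`#Sel₂ = 8` + A MOVER ⟹ `𝓛(n)` ODD AND `rank E_n(ℚ) = 1`** for square-free `n ≡ 6 (mod 8)` (no GZK): the argument of
`rankOne_and_odd_scriptL_of_selmerEight_of_mover` (p672160) with the even torsion lemma of §2 (the mover fixes `√−2` since `2 ∣ n`).
[cite: TianYuanZhang2017, Thm. 3.5 (p0011 L94–L100), Lemma 3.18 (p0017 L152–L153)] [cite: SilvermanAEC2009, Thm. X.4.2, Prop. X.4.9] -/
theorem rankOne_and_odd_scriptL_of_selmerEight_of_mover_even (hsq : Squarefree n) (h8 : n % 8 = 6)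
    (hsel : haveI := isElliptic_congruentNumberCurve hsq.ne_zero;
      Nat.card ((congruentNumberCurve n).selmerGroup 2) = 8)
    (D : GenusPointData n) (h35 : D.thm35Main) (hLs : D.scriptLSpec) (h318 : D.lemma318)
    (g : D.H ≃ₐ[ℚ] D.H) (hgi : g D.im = D.im) (hgd : ∀ d ∈ n.divisors, g (D.sqrtNeg d) = D.sqrtNeg d)
    (hmove : D.galPt g (D.P n) ≠ D.P n) :
    haveI := isElliptic_congruentNumberCurve hsq.ne_zero
    (congruentNumberCurve n).mordellWeilRank = 1 ∧ ∀ L : ℤ, IsScriptL n L → ¬ (2 : ℤ) ∣ L := by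
  have hn0 : n ≠ 0 := hsq.ne_zero
  haveI := isElliptic_congruentNumberCurve hn0
  have heven : Even n := Nat.even_iff.mpr (by omega)
  have hn : n ∈ n.divisors := Nat.mem_divisors_self n hn0
  have h2 : 2 ∈ n.divisors := Nat.mem_divisors.mpr ⟨even_iff_two_dvd.mp heven, hn0⟩
  have hg2 : g (D.sqrtNeg 2) = D.sqrtNeg 2 := hgd 2 h2
  have hn1 : 1 < n := by omega
  have hLD : IsScriptL n (D.scriptL n) := hLs n hn hn1
  have hL0 : D.scriptL n ≠ 0 := scriptL_ne_zero_of_mover_even hsq heven D h35 h318 g hgi hg2 hmove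
  have hPnt : ¬ IsOfFinAddOrder (D.P n) := not_isOfFinAddOrder_of_mover_even D hn0 heven h318 g hgi hg2 hmove
  -- `2`-descent: rank ≤ 1 with the dichotomy
  have hcases := mordellWeilRank_card_sha_two_cases_of_card_selmerGroup_two_eq_eight hn0 hsel
  have hr1 : (congruentNumberCurve n).mordellWeilRank ≤ 1 := by
    rcases hcases with ⟨h, -⟩ | ⟨h, -⟩ <;> omega
  obtain ⟨R, hR⟩ := stub_S0 (n := n) hr1
  obtain ⟨Q₁, hQ₁, hQfix⟩ := exists_half_fixed hsq hn D R
  obtain ⟨u, hu, hrel⟩ := two_smul_genusPoint_sub_smul_half_isOfFinAddOrder hsq hr1 D h35 hL0 hR hQ₁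
  -- rank `0` is impossible: `R`, hence `Q₁`, hence `2P(n)`, hence `P(n)` would be torsion
  have hrank : (congruentNumberCurve n).mordellWeilRank = 1 := by
    rcases hcases with ⟨h, -⟩ | ⟨h0, -⟩
    · exact h
    · exfalso
      haveI : Finite (congruentNumberCurve n).toAffine.Point :=
        (congruentNumberCurve n).mordellWeilRank_eq_zero_iff_finite.mp h0
      have hRt : IsOfFinAddOrder R := isOfFinAddOrder_of_finite R
      have hQt : IsOfFinAddOrder Q₁ := by
        have hφt : IsOfFinAddOrder (φH D Q₁) := by
          rw [hQ₁]; exact AddMonoidHom.isOfFinAddOrder _ (AddMonoidHom.isOfFinAddOrder _ hRt)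
        obtain ⟨m, hm, hmQ⟩ := (isOfFinAddOrder_iff_nsmul_eq_zero).mp hφt
        have hker : φH D (m • Q₁) = 0 := by rw [map_nsmul, hmQ]
        have h2m : (2 * m) • Q₁ = 0 := by
          rw [mul_comm, mul_nsmul]
          rcases (φH_eq_zero_iff D _).mp hker with e | e
          · rw [e, smul_zero]
          · rw [e, two_nsmul_tauOne]
        exact isOfFinAddOrder_iff_nsmul_eq_zero.mpr ⟨2 * m, by omega, h2m⟩
      apply hPnt
      have h2P : IsOfFinAddOrder ((2 : ℤ) • D.P n) := by
        have e : (2 : ℤ) • D.P n = ((2 : ℤ) • D.P n - (u * D.scriptL n) • Q₁) + (u * D.scriptL n) • Q₁ := by abel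
        rw [e]; exact hrel.add hQt.zsmul
      exact LevelTwo.isOfFinAddOrder_of_zsmul two_ne_zero h2P
  refine ⟨hrank, fun L hL h2d => ?_⟩
  have h2' : (2 : ℤ) ∣ D.scriptL n := by
    rcases LevelTwo.eq_or_eq_neg_of_isScriptL hL hLD with e | e
    · rwa [← e]
    · rw [← dvd_neg, ← e]; exact h2d
  obtain ⟨c, hc⟩ := h2'
  have ht : IsOfFinAddOrder (D.P n - (u * c) • Q₁) := by
    have e : (2 : ℤ) • D.P n - (u * D.scriptL n) • Q₁ = (2 : ℤ) • (D.P n - (u * c) • Q₁) := by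
      rw [hc]; module
    rw [e] at hrel
    exact LevelTwo.isOfFinAddOrder_of_zsmul two_ne_zero hrel
  apply hmove
  have eP : D.P n = (D.P n - (u * c) • Q₁) + (u * c) • Q₁ := by abel
  rw [eP, map_add, map_zsmul, galPt_eq_self_of_isOfFinAddOrder_even D hn0 heven h318 g hgi hg2 ht, hQfix g hgi hgd]

/-- **THE GALOIS-MOVER DOOR, EVEN CASE.**  Square-free `n ≡ 6 (mod 8)` with `#Sel⁽²⁾(E_n/ℚ) = 8`; `D : GenusPointData n` with the
displayed main clause of Thm 3.5, integrality and Lemma 3.18; an automorphism `g` of `ℍ′_n` fixing `i` and every `√−d` (`d ∣ n`) that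
MOVES `P(n)`.  Then **`ord_{s=1} L(E_n, s) = 1`, `rank E_n(ℚ) = 1`, `Ш(E_n)[2^∞] = 0` and `BSD(E_n, 2)`** (`𝓛(n)` odd ⟹ `r_an = 1`;
`#Sel₂ = 8` and rank `1` ⟹ `Ш[2^∞] = ⊥`; `L′(E_n,1) = 2^{2k−2}𝓛²·Ω·Reg`, `#E_n(ℚ)_tor = 4`, `∏c_ℓ = 2^{2k+2}` ⟹ Miller's `BSD(E_n,2)`).
[cite: TianYuanZhang2017, Thm. 3.5 and §1 (1.1)] [cite: SilvermanAEC2009, Thm. X.4.2] [cite: Miller2011LMS, Def. 1.1 (arXiv:1010.2431 p. 3)] -/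
theorem rankOne_sha_bsdp_two_congruentNumberCurve_of_selmerEight_of_mover_even (hsq : Squarefree n)
    (h8 : n % 8 = 6)
    (hsel : haveI := isElliptic_congruentNumberCurve hsq.ne_zero;
      Nat.card ((congruentNumberCurve n).selmerGroup 2) = 8)
    (D : GenusPointData n) (h35 : D.thm35Main) (hLs : D.scriptLSpec) (h318 : D.lemma318)
    (g : D.H ≃ₐ[ℚ] D.H) (hgi : g D.im = D.im) (hgd : ∀ d ∈ n.divisors, g (D.sqrtNeg d) = D.sqrtNeg d)
    (hmove : D.galPt g (D.P n) ≠ D.P n) :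
    haveI := isElliptic_congruentNumberCurve hsq.ne_zero
    (congruentNumberCurve n).analyticRank = 1 ∧ (congruentNumberCurve n).mordellWeilRank = 1 ∧
      AddCommGroup.primaryComponent (congruentNumberCurve n).sha 2 = ⊥ ∧
      BSDp (congruentNumberCurve n) 2 := by
  have hn0 : n ≠ 0 := hsq.ne_zero
  haveI := isElliptic_congruentNumberCurve hn0
  haveI : Fact (Nat.Prime 2) := ⟨Nat.prime_two⟩
  have h8' : n % 8 = 5 ∨ n % 8 = 6 ∨ n % 8 = 7 := Or.inr (Or.inl h8)
  have hn : n ∈ n.divisors := Nat.mem_divisors_self n hn0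
  have hn1 : 1 < n := by omega
  have hLD : IsScriptL n (D.scriptL n) := hLs n hn hn1
  obtain ⟨hrank, hoddL⟩ :=
    rankOne_and_odd_scriptL_of_selmerEight_of_mover_even hsq h8 hsel D h35 hLs h318 g hgi hgd hmove
  have hLodd : Odd (D.scriptL n) := Int.not_even_iff_odd.mp fun he => hoddL _ hLD (even_iff_two_dvd.mp he)
  have hL0 : D.scriptL n ≠ 0 := fun h => by simp [h] at hLodd
  have hr1 : (congruentNumberCurve n).analyticRank = 1 :=
    analyticRank_congruentNumberCurve_eq_one_of_isScriptL hsq h8' hLD hL0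
  have hbot := P2.primaryComponent_sha_two_eq_bot_of_card_selmerGroup_eq_eight hn0 hrank hsel
  refine ⟨hr1, hrank, hbot, ?_⟩
  have hlead : (congruentNumberCurve n).leadingLCoeff =
      (((2 : ℚ) ^ twoExponent n * (D.scriptL n : ℚ) ^ 2 : ℚ) : ℂ) *
        ((congruentNumberCurve n).realPeriodRat : ℂ) * ((congruentNumberCurve n).regulator : ℂ) := by
    rw [leadingLCoeff_congruentNumberCurve_eq_of_isScriptL (Nat.pos_of_ne_zero hn0) hr1 hLD]
    push_cast; ring
  have hx0 : (2 : ℚ) ^ twoExponent n * (D.scriptL n : ℚ) ^ 2 ≠ 0 := by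
    have hL0' : (D.scriptL n : ℚ) ≠ 0 := by exact_mod_cast hL0
    exact mul_ne_zero (zpow_ne_zero _ two_ne_zero) (pow_ne_zero _ hL0')
  rw [P2.bsdp_iff_valuation_of_leadingLCoeff_of_primaryComponent_eq_bot (congruentNumberCurve n) 2
    (hrank.trans hr1.symm) hx0 hlead hbot, P2.padicValRat_two_zpow_mul_sq hLodd,
    tamagawaProduct_congruentNumberCurve_eq_two_pow hsq, torsionOrder_congruentNumberCurve hsq,
    padicValNat.prime_pow, show (4 : ℕ) = 2 ^ 2 by norm_num, padicValNat.prime_pow]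
  unfold twoExponent oddPrimeFactorCount oddIndicator
  split_ifs <;> push_cast <;> omega

/-! ## §4 Keyed on the named fact -/

/-- **The even Galois-mover door from the named fact `tyz_genusPointData`** (TYZ §3 AS PRINTED): for square-free `n ≡ 6 (mod 8)` with
`#Sel⁽²⁾(E_n/ℚ) = 8`, IF for the printed data some automorphism of `ℍ′_n` trivial on `i` and the `√−d` moves `P(n)`, then
`ord = rank = 1`, `Ш[2^∞] = 0`, `BSD(E_n, 2)`. [cite: TianYuanZhang2017, Thm. 3.5 and Lemma 3.18] [cite: Miller2011LMS, Def. 1.1] -/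
theorem rankOne_sha_bsdp_two_congruentNumberCurve_of_selmerEight_of_mover_even_of_tyz (hTYZ : tyz_genusPointData)
    (hsq : Squarefree n) (h8 : n % 8 = 6)
    (hsel : haveI := isElliptic_congruentNumberCurve hsq.ne_zero;
      Nat.card ((congruentNumberCurve n).selmerGroup 2) = 8)
    (hmover : ∀ D : GenusPointData n, D.Printed →
      ∃ g : D.H ≃ₐ[ℚ] D.H, g D.im = D.im ∧ (∀ d ∈ n.divisors, g (D.sqrtNeg d) = D.sqrtNeg d) ∧
        D.galPt g (D.P n) ≠ D.P n) :
    haveI := isElliptic_congruentNumberCurve hsq.ne_zero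
    (congruentNumberCurve n).analyticRank = 1 ∧ (congruentNumberCurve n).mordellWeilRank = 1 ∧
      AddCommGroup.primaryComponent (congruentNumberCurve n).sha 2 = ⊥ ∧
      BSDp (congruentNumberCurve n) 2 := by
  have h8' : n % 8 = 5 ∨ n % 8 = 6 ∨ n % 8 = 7 := Or.inr (Or.inl h8)
  obtain ⟨D, hD⟩ := hTYZ n hsq h8'
  obtain ⟨g, hgi, hgd, hmove⟩ := hmover D hD
  obtain ⟨hLs, -, -, -, h35, -, -, -, h318, -, -⟩ := hD
  exact rankOne_sha_bsdp_two_congruentNumberCurve_of_selmerEight_of_mover_even hsq h8 hsel D h35 hLs h318 g hgi hgd hmove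

end Summit.BirchSwinnertonDyer.PrintCf2.GaloisMotion

end
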